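import Summits.ValiantsHypothesis.ValiantsHypothesis.Theses.DivisionGap

/-!
# Crux `DivisionGap.ZeroOneTransfer` (stmt-ValiantsHypothesis-5066), line `charged-uncharged` —
registered stub `stub_zotOfUniform`: THE UNIFORM FORM OF H2 IMPLIES H2 (bookkeeping)

**Claim settled** (stub C1 of the lead's skeleton, TRUE): the UNIFORM form of `ZeroOneTransfer` —
for every exponent `e` ONE constant `c` such that every 0/1 polynomial `f` over `ℝ≥0` in a finite
variable type of size `≤ n^e + e`, of total degree `≤ n^e + e` and of `ℂ`-complexity `≤ n^e + e`,
has a nonzero `h` with `L₊(f·h) + L₊(h) ≤ 2^((log₂ n + c)^c)` — implies `ZeroOneTransfer` itself.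

Proof.  Unfold `IsVPFamily = IsPFamily ∧ IsPComputable` (Bürgisser 2000, Defs. 2.2–2.4): a 0/1
`VP_ℂ` family comes with three p-bounds `n ^ cᵢ + cᵢ` — on the number of variables, on the total
degree of the complexified polynomial, and on its complexity.  One exponent `e = max c₁ (max c₂ c₃)`
dominates all three (`a ≤ b → n ^ a + a ≤ n ^ b + b`, also at `n = 0` where `0 ^ 0 = 1`), the total
degree is unchanged by the injective coefficient map `ℝ≥0 → ℝ → ℂ` (equal supports,
`MvPolynomial.support_map_of_injective`), and the uniform constant for `e` serves every level `n`.

Unconditional (axioms `propext`, `Classical.choice`, `Quot.sound`). References: [Burgisser2000]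
Defs. 2.1–2.4 (the classes); the statement is folklore bookkeeping.
-/

set_option linter.dupNamespace false

namespace Summit.ValiantsHypothesis.ValiantsHypothesis.Theorems.DivisionGapZeroOneTransfer

open MvPolynomial Literature.Computability.AlgebraicComplexity
open Summit.ValiantsHypothesis.ValiantsHypothesis.Theses.DivisionGap

/-- Monotonicity of the p-bound shape `a ↦ n ^ a + a` in the exponent, including the degenerate
base `n = 0` (where `0 ^ 0 = 1 ≤ b` for `0 < b`). [folklore] -/
theorem pow_add_self_le_pow_add_self {n a b : ℕ} (h : a ≤ b) : n ^ a + a ≤ n ^ b + b := by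
  rcases Nat.eq_zero_or_pos n with rfl | hn
  · rcases Nat.eq_zero_or_pos a with rfl | ha
    · rcases Nat.eq_zero_or_pos b with rfl | hb
      · exact le_rfl
      · rw [Nat.zero_pow hb, pow_zero]
        omega
    · rw [Nat.zero_pow ha, Nat.zero_pow (lt_of_lt_of_le ha h)]
      omega
  · exact Nat.add_le_add (Nat.pow_le_pow_right hn h) h

/-- **Stub C1 — the uniform form implies the crux** (bookkeeping).  The uniform form: for every
exponent `e` ONE constant `c` such that every 0/1 polynomial `f` over `ℝ≥0` in a finite variable
type of size `≤ n^e + e`, of total degree `≤ n^e + e` and of `ℂ`-complexity `≤ n^e + e`, has a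
nonzero `h` with `L₊(f·h) + L₊(h) ≤ 2^((log₂ n + c)^c)`.  Given a 0/1 `VP_ℂ` family, one exponent
`e` dominates the three p-bounds of `IsVPFamily` (`n^a + a ≤ n^e + e` for `a ≤ e`, also at
`n = 0`), the total degree of `f n` equals that of its complexification (the coefficient map
`ℝ≥0 → ℝ → ℂ` is injective, so the support is preserved), and the uniform constant for `e` serves
every level `n`. [folklore] -/
theorem stub_zotOfUniform :
    (∀ e : ℕ, ∃ c : ℕ, ∀ (n : ℕ) (τ : Type) [Fintype τ] (f : MvPolynomial τ NNReal),
      (∀ m, MvPolynomial.coeff m f = 0 ∨ MvPolynomial.coeff m f = 1) →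
      Fintype.card τ ≤ n ^ e + e → f.totalDegree ≤ n ^ e + e →
      Literature.Computability.AlgebraicComplexity.complexity
        (MvPolynomial.map (Complex.ofRealHom.comp NNReal.toRealHom) f) ≤ n ^ e + e →
      ∃ h : MvPolynomial τ NNReal, h ≠ 0 ∧
        Literature.Computability.AlgebraicComplexity.complexity (f * h) +
          Literature.Computability.AlgebraicComplexity.complexity h ≤ 2 ^ ((Nat.log 2 n + c) ^ c)) →
    ZeroOneTransfer := by
  intro hU σ _ f h01 hVP
  obtain ⟨⟨⟨c₁, hc₁⟩, ⟨c₂, hc₂⟩⟩, ⟨c₃, hc₃⟩⟩ := hVP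
  obtain ⟨c, hc⟩ := hU (max c₁ (max c₂ c₃))
  -- the complexification of coefficients `ℝ≥0 → ℝ → ℂ` is injective, so supports (hence total
  -- degrees) are preserved
  have hinj : Function.Injective (Complex.ofRealHom.comp NNReal.toRealHom) := fun a b hab => by
    have hab' : ((a : ℝ) : ℂ) = ((b : ℝ) : ℂ) := hab
    exact_mod_cast hab'
  have hdeg : ∀ n, (f n).totalDegree =
      (MvPolynomial.map (Complex.ofRealHom.comp NNReal.toRealHom) (f n)).totalDegree := fun n => by
    rw [MvPolynomial.totalDegree, MvPolynomial.totalDegree,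
      MvPolynomial.support_map_of_injective _ hinj]
  refine ⟨c, fun n => hc n (σ n) (f n) (h01 n) ?_ ?_ ?_⟩
  · exact (hc₁ n).trans (pow_add_self_le_pow_add_self (le_max_left _ _))
  · calc (f n).totalDegree
        = (MvPolynomial.map (Complex.ofRealHom.comp NNReal.toRealHom) (f n)).totalDegree := hdeg n
      _ ≤ n ^ c₂ + c₂ := hc₂ n
      _ ≤ _ := pow_add_self_le_pow_add_self ((le_max_left _ _).trans (le_max_right _ _))
  · exact (hc₃ n).trans
      (pow_add_self_le_pow_add_self ((le_max_right _ _).trans (le_max_right _ _)))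

end Summit.ValiantsHypothesis.ValiantsHypothesis.Theorems.DivisionGapZeroOneTransfer
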